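import Summits.CriticalPhenomena.PercolationContinuityZ3.Theorems.PercNearOneGluingNoHeavyLowerTailSahiThreeCopyPairStepCumulation

/-!
# `NoHeavyLowerTail` (crux stmt-CriticalPhenomena-4575), Sahi programme: **(SC) WITH ONE CUMULATION SLOT — every principal up-set and
# every nonnegative combination of principal cylinders (Sahi's cumulation cone), by coordinate relabeling and linearity**

Support file (Sahi cell, seat `prim-sahi-p1`, generation 58; `--supports stmt-CriticalPhenomena-4575`); companion of `…PairStepCumulation`
(the initial-support case `initPrin d k = x₀⋯x_{k−1}`).  Pure proofs plus one `def` (`relab`, the coordinate-relabeling equivalence of the cube);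
no `sorry`, standard axioms.

* `N3_relab`: **relabeling invariance** `N_{b∘σ}(F;G;H) = N_b(F∘ρ_σ; G∘ρ_σ; H∘ρ_σ)`, `ρ_σ x = x ∘ σ` (`σ` a permutation of the coordinates); hence
  `tc_relab`, `scx_relab`.
* `pairStep_principal`: the pair step `0 ≤ E_b(a,v,w|a,g,h)` for `a = x_S := initPrin d k ∘ ρ_σ` — EVERY principal cylinder `Π_{i∈S} x_i`
  (`S = σ({0,…,k−1})`), `v ≤ g`, `w ≤ h` arbitrary nonnegative monotone; `sliceLaw_principal_free`: **(SC) for `F = x_S` on the old coordinates and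
  ARBITRARY `G, H`.**
* `scx_pair_add / scx_pair_smul`: `E_b(a,v,w|a,g,h)` is LINEAR in `a`; `pairStep_cumulation` / `sliceLaw_cumulation_free`: the same for every finite
  nonnegative combination `a = Σ_j c_j · x_{S_j}` of principal cylinders — in particular every coordinate product `Π_i(α_i + β_i x_i)`, `α, β ≥ 0`
  (expand the product), i.e. Sahi's cumulation cone in the free slot.  This is the (SC)-analogue of gen53's `tc_cprod_nonneg` (3C with a cumulation
  slot) and strictly stronger on that class.  [this work]
-/

namespace Summit.CriticalPhenomena.PercolationContinuityZ3.Theorems.SahiThreeCopy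

open Finset Function Literature.Combinatorics.Sahi2008
open scoped BigOperators

noncomputable section

variable {d : ℕ}

/-! ### §1 Relabeling coordinates -/

/-- Relabeling the coordinates of a point by a permutation `σ`: `(relab σ x) i = x (σ i)`. [this work] -/
def relab (σ : Equiv.Perm (Fin d)) : Pt d ≃ Pt d where
  toFun x := x ∘ σ
  invFun x := x ∘ σ.symm
  left_inv x := by funext i; simp
  right_inv x := by funext i; simp

/-- `relab σ x = x ∘ σ`. [this work] -/
theorem relab_apply (σ : Equiv.Perm (Fin d)) (x : Pt d) : relab σ x = x ∘ σ := rfl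

/-- `relab σ` is monotone (an order automorphism of the cube). [this work] -/
theorem relab_monotone (σ : Equiv.Perm (Fin d)) : Monotone (relab σ) := fun _ _ hxy i => hxy (σ i)

/-- Precomposition with `relab σ` preserves monotonicity. [this work] -/
theorem monotone_comp_relab (σ : Equiv.Perm (Fin d)) {f : Pt d → ℝ} (hf : Monotone f) : Monotone (f ∘ relab σ) :=
  hf.comp (relab_monotone σ)

/-- Undoing a relabeling: `(f ∘ ρ_{σ⁻¹}) ∘ ρ_σ = f`. [this work] -/
theorem comp_relab_symm_relab (σ : Equiv.Perm (Fin d)) (f : Pt d → ℝ) : (f ∘ relab σ.symm) ∘ relab σ = f := by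
  funext x
  simp only [Function.comp_apply, relab_apply]
  congr 1
  funext i
  simp

/-- The arrangement condition transports under relabeling. [this work] -/
theorem isArr_relab (σ : Equiv.Perm (Fin d)) (b : Fin d → ℕ) (x y z : Pt d) :
    IsArr (b ∘ σ) (x ∘ σ) (y ∘ σ) (z ∘ σ) ↔ IsArr b x y z := by
  unfold IsArr
  constructor
  · intro h i
    have := h (σ.symm i)
    simpa using this
  · intro h i
    exact h (σ i)

/-- ★ **Relabeling invariance of the three-copy functional**: `N_{b∘σ}(F;G;H) = N_b(F∘ρ_σ; G∘ρ_σ; H∘ρ_σ)`. [this work] -/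
theorem N3_relab (σ : Equiv.Perm (Fin d)) (b : Fin d → ℕ) (F G H : Pt d → ℝ) :
    N3 (b ∘ σ) F G H = N3 b (F ∘ relab σ) (G ∘ relab σ) (H ∘ relab σ) := by
  unfold N3
  rw [← Equiv.sum_comp (relab σ)]
  refine sum_congr rfl fun x _ => ?_
  rw [← Equiv.sum_comp (relab σ)]
  refine sum_congr rfl fun y _ => ?_
  rw [← Equiv.sum_comp (relab σ)]
  refine sum_congr rfl fun z _ => ?_
  simp only [Function.comp_apply, relab_apply, isArr_relab]

/-- Relabeling invariance of `c_b`. [this work] -/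
theorem tc_relab (σ : Equiv.Perm (Fin d)) (b : Fin d → ℕ) (f g h : Pt d → ℝ) :
    tc (b ∘ σ) f g h = tc b (f ∘ relab σ) (g ∘ relab σ) (h ∘ relab σ) := by
  unfold tc
  simp only [N3_relab]
  rfl

/-- Relabeling invariance of the one-cube (SC)-excess `E_b`. [this work] -/
theorem scx_relab (σ : Equiv.Perm (Fin d)) (b : Fin d → ℕ) (u v w f g h : Pt d → ℝ) :
    scx (b ∘ σ) u v w f g h = scx b (u ∘ relab σ) (v ∘ relab σ) (w ∘ relab σ) (f ∘ relab σ) (g ∘ relab σ) (h ∘ relab σ) := by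
  unfold scx
  simp only [N3_relab]
  rfl

/-! ### §2 The pair step and (SC) for every principal cylinder -/

/-- ★ **THE PAIR STEP FOR EVERY PRINCIPAL CYLINDER**: `0 ≤ E_b(x_S, v, w | x_S, g, h)` for `x_S = initPrin d k ∘ ρ_σ` and nonnegative monotone `v ≤ g`,
`w ≤ h` (relabel to an initial support and apply `pairStep_initPrincipal` at the relabeled profile). [this work] -/
theorem pairStep_principal (σ : Equiv.Perm (Fin d)) (k : ℕ) (b : Fin d → ℕ) {v g w h : Pt d → ℝ}
    (hv : ∀ x, 0 ≤ v x) (hw : ∀ x, 0 ≤ w x) (hvm : Monotone v) (hgm : Monotone g) (hwm : Monotone w) (hhm : Monotone h)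
    (hvg : ∀ x, v x ≤ g x) (hwh : ∀ x, w x ≤ h x) :
    0 ≤ scx b (initPrin d k ∘ relab σ) v w (initPrin d k ∘ relab σ) g h := by
  -- the data are `(· ∘ ρ_{σ⁻¹}) ∘ ρ_σ`; un-relabel to the profile `b ∘ σ` and the initial principal `initPrin d k`
  have key := pairStep_initPrincipal (d := d) k (b ∘ σ) (v := v ∘ relab σ.symm) (g := g ∘ relab σ.symm)
    (w := w ∘ relab σ.symm) (h := h ∘ relab σ.symm) (fun x => hv _) (fun x => hw _) (monotone_comp_relab _ hvm)
    (monotone_comp_relab _ hgm) (monotone_comp_relab _ hwm) (monotone_comp_relab _ hhm) (fun x => hvg _) (fun x => hwh _)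
  have e := scx_relab σ b (initPrin d k) (v ∘ relab σ.symm) (w ∘ relab σ.symm) (initPrin d k) (g ∘ relab σ.symm)
    (h ∘ relab σ.symm)
  rw [comp_relab_symm_relab, comp_relab_symm_relab, comp_relab_symm_relab, comp_relab_symm_relab] at e
  rw [← e]
  exact key

/-- ★★ **(SC) WITH A PRINCIPAL SLOT**: for `F = x_S ∘ tail` on `{0,1}^{d+2}` (`x_S = initPrin (d+1) k ∘ ρ_σ`, any principal cylinder of the old coordinates)
and ARBITRARY nonnegative monotone `G, H`: `2·c_B(F¹,G¹,H¹) ≤ c_{(2,B)}(F,G,H)`. [this work] -/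
theorem sliceLaw_principal_free (σ : Equiv.Perm (Fin (d + 1))) (k : ℕ) (B : Fin (d + 1) → ℕ) {G H : Pt (d + 2) → ℝ}
    (hG : ∀ x, 0 ≤ G x) (hH : ∀ x, 0 ≤ H x) (hGm : Monotone G) (hHm : Monotone H) :
    2 * tc B (sec (fun x : Pt (d + 2) => (initPrin (d + 1) k ∘ relab σ) (Fin.tail x)) true) (sec G true) (sec H true) ≤
      tc (Fin.cons 2 B : Fin (d + 2) → ℕ) (fun x => (initPrin (d + 1) k ∘ relab σ) (Fin.tail x)) G H := by
  have hs : ∀ ε : Bool, sec (fun x : Pt (d + 2) => (initPrin (d + 1) k ∘ relab σ) (Fin.tail x)) ε = initPrin (d + 1) k ∘ relab σ := by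
    intro ε; funext x; simp [sec, Fin.tail_cons]
  have e := tc_cons_two_sub_two_eq_scx B (fun x : Pt (d + 2) => (initPrin (d + 1) k ∘ relab σ) (Fin.tail x)) G H
  rw [hs, hs] at e
  have key := pairStep_principal σ k B (v := sec G false) (g := sec G true) (w := sec H false) (h := sec H true)
    (sec_nonneg hG false) (sec_nonneg hH false) (sec_monotone hGm false) (sec_monotone hGm true) (sec_monotone hHm false)
    (sec_monotone hHm true) (sec_false_le_sec_true hGm) (sec_false_le_sec_true hHm)
  rw [hs]
  linarith

/-! ### §3 Linearity in the cumulation slot: the whole cumulation cone -/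

/-- `E_b(a,v,w|a,g,h)` is ADDITIVE in `a` (every term carries exactly one `a`-factor). [this work] -/
theorem scx_pair_add (b : Fin d → ℕ) (a₁ a₂ v w g h : Pt d → ℝ) :
    scx b (a₁ + a₂) v w (a₁ + a₂) g h = scx b a₁ v w a₁ g h + scx b a₂ v w a₂ g h := by
  unfold scx
  simp only [add_mul, N3_add_left, N3_add_mid]
  ring

/-- `E_b(a,v,w|a,g,h)` is HOMOGENEOUS in `a`. [this work] -/
theorem scx_pair_smul (b : Fin d → ℕ) (c : ℝ) (a v w g h : Pt d → ℝ) :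
    scx b (c • a) v w (c • a) g h = c * scx b a v w a g h := by
  unfold scx
  simp only [smul_mul_assoc, N3_smul_left, N3_smul_mid]
  ring

/-- ★★ **THE PAIR STEP ON THE CUMULATION CONE**: for `a = Σ_{j ∈ J} c_j · x_{S_j}` a finite nonnegative combination of principal cylinders
(`x_{S_j} = initPrin d (k j) ∘ ρ_{σ j}`; every coordinate product `Π_i(α_i + β_i x_i)` with `α, β ≥ 0` is of this form) and nonnegative monotone `v ≤ g`, `w ≤ h`:
`0 ≤ E_b(a,v,w|a,g,h)`. [this work] -/
theorem pairStep_cumulation {ι : Type*} (J : Finset ι) (c : ι → ℝ) (hc : ∀ j ∈ J, 0 ≤ c j) (σ : ι → Equiv.Perm (Fin d)) (k : ι → ℕ)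
    (b : Fin d → ℕ) {v g w h : Pt d → ℝ} (hv : ∀ x, 0 ≤ v x) (hw : ∀ x, 0 ≤ w x) (hvm : Monotone v) (hgm : Monotone g)
    (hwm : Monotone w) (hhm : Monotone h) (hvg : ∀ x, v x ≤ g x) (hwh : ∀ x, w x ≤ h x) :
    0 ≤ scx b (∑ j ∈ J, c j • (initPrin d (k j) ∘ relab (σ j))) v w (∑ j ∈ J, c j • (initPrin d (k j) ∘ relab (σ j))) g h := by
  classical
  induction J using Finset.induction_on with
  | empty =>
    have h0 := scx_pair_smul b 0 v v w g h
    rw [zero_smul, zero_mul] at h0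
    rw [sum_empty, h0]
  | insert j J hj ih =>
    rw [sum_insert hj, scx_pair_add, scx_pair_smul]
    exact add_nonneg (mul_nonneg (hc j (mem_insert_self j J)) (pairStep_principal (σ j) (k j) b hv hw hvm hgm hwm hhm hvg hwh))
      (ih fun i hi => hc i (mem_insert_of_mem hi))

/-- ★★ **(SC) WITH A CUMULATION SLOT**: for `F = a ∘ tail`, `a = Σ_j c_j · x_{S_j}` a nonnegative combination of principal cylinders of the old
coordinates, and ARBITRARY nonnegative monotone `G, H` on `{0,1}^{d+2}`: `2·c_B(F¹,G¹,H¹) ≤ c_{(2,B)}(F,G,H)`. [this work] -/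
theorem sliceLaw_cumulation_free {ι : Type*} (J : Finset ι) (c : ι → ℝ) (hc : ∀ j ∈ J, 0 ≤ c j) (σ : ι → Equiv.Perm (Fin (d + 1)))
    (k : ι → ℕ) (B : Fin (d + 1) → ℕ) {G H : Pt (d + 2) → ℝ} (hG : ∀ x, 0 ≤ G x) (hH : ∀ x, 0 ≤ H x) (hGm : Monotone G)
    (hHm : Monotone H) :
    2 * tc B (sec (fun x : Pt (d + 2) => (∑ j ∈ J, c j • (initPrin (d + 1) (k j) ∘ relab (σ j))) (Fin.tail x)) true)
        (sec G true) (sec H true) ≤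
      tc (Fin.cons 2 B : Fin (d + 2) → ℕ) (fun x => (∑ j ∈ J, c j • (initPrin (d + 1) (k j) ∘ relab (σ j))) (Fin.tail x)) G H := by
  set a : Pt (d + 1) → ℝ := ∑ j ∈ J, c j • (initPrin (d + 1) (k j) ∘ relab (σ j)) with ha
  have hs : ∀ ε : Bool, sec (fun x : Pt (d + 2) => a (Fin.tail x)) ε = a := by
    intro ε; funext x; simp [sec, Fin.tail_cons]
  have e := tc_cons_two_sub_two_eq_scx B (fun x : Pt (d + 2) => a (Fin.tail x)) G H
  rw [hs, hs] at e
  have key := pairStep_cumulation J c hc σ k B (v := sec G false) (g := sec G true) (w := sec H false) (h := sec H true)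
    (sec_nonneg hG false) (sec_nonneg hH false) (sec_monotone hGm false) (sec_monotone hGm true) (sec_monotone hHm false)
    (sec_monotone hHm true) (sec_false_le_sec_true hGm) (sec_false_le_sec_true hHm)
  rw [← ha] at key
  rw [hs]
  linarith

end

end Summit.CriticalPhenomena.PercolationContinuityZ3.Theorems.SahiThreeCopy
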